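import Literature.NumberTheory.EllipticCurves.GreenbergVatsal2000.GreenbergSelmerGroups
import Literature.NumberTheory.EllipticCurves.SubgroupSelmerCocycleCriteriaProofs
import Literature.NumberTheory.EllipticCurves.SubgroupSelmerProofs
import Literature.NumberTheory.EllipticCurves.ZpExtension
import HarnessLib

/-!
# The unramified-outside-`S₀` condition under restriction to a smaller subgroup: `res_{H' ≤ H}` preserves it, and reflects it
# at every place whose inertia group `H ⊓ I_v` already lies in `H'` (e.g. `H' = H ⊓ Γ_F` for `F/K` unramified outside `S₀ ∪ {p}`)
# (lead prover bsd-wall-rtt-p2 g10; `--supports stmt-BirchSwinnertonDyer-26074`; route-independent, closes nothing)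

HONEST FRAMING. THEOREMS ONLY (no definition, no named fact, no `sorry`); Galois-cohomological plumbing over an arbitrary number
field `K`; nothing about any curve or count is asserted; BSD is not proved by any of this. No route (`Theses`) file is imported.

WHAT. The counted set of the crux `(R≥)ᵖ` `ResidualThetaCountLowerPureAtTwo` (item stmt-BirchSwinnertonDyer-26074) imposes
`GreenbergVatsal2000.unramifiedOutside Γ_{ℚ_∞} W[2] 2 S₀`; the CM-endpoint levers move the classes to `Γ_{K_∞} = Γ_{ℚ_∞} ∩ Γ_K` by
restriction (`ResidualLayer.resOfLe_kerSubgroup_inf_bijective_invariants`, p618869). This file records how the unramified condition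
travels along `res : H¹(H, M) → H¹(H', M)` for subgroups `H' ≤ H` of `Γ_K`:
* `resOfLe_mem_unramifiedKer` — `y` unramified at `v` ⟹ `res y` unramified at `v` (always);
* `mem_unramifiedKer_of_resOfLe_mem` — conversely when `H ⊓ I_v ≤ H'` (then `H ⊓ I_v = H' ⊓ I_v`);
* `resOfLe_mem_unramifiedOutside`, `mem_unramifiedOutside_iff_resOfLe_mem` — the same for `unramifiedOutside H M p S₀` (all
  conjugates, all `v ∉ S₀` with `v ∤ p`), the converse under `∀ v ∉ S₀, v ∤ p → H ⊓ I_v ≤ H'`;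
* `mem_unramifiedOutside_kerSubgroup_iff_resOfLe_inf_mem` — the instance `H = Γ_{K_∞}` (`κ.kerSubgroup`, any `ℤ_p`-extension),
  `H' = Γ_{K_∞} ∩ N` for a normal subgroup `N` containing `I_v` for every `v ∉ S₀`, `v ∤ p` (i.e. `K̄^N/K` unramified there).
So on the habitat (`K = ℚ`, `p = 2`, `N = Γ_{ℚ(√Δ_W)}`, every prime ramified in `ℚ(√Δ_W)` divides `Δ_W` hence lies in `S₀ ⊇ bad(W)`,
and `2 ∤ disc` since `Δ_min ≡ 5 (8)`) the unramified clause of `R⁺_{S₀}(W[2]/ℚ_∞)` is EXACTLY the unramified clause over `K_∞`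
under `res`; only the clause at `v ∣ 2` remains line-specific.

References: [GreenbergVatsal2000] §2 pp. 16–17, 23 (`H¹(ℚ_Σ/ℚ_∞, A)` place by place); [SerreGaloisCohomology1997] I.§2.4
(functoriality of restriction); [NeukirchSchmidtWingberg2008] (1.5.2), (1.6.3).
-/

set_option autoImplicit false
-- D-0017: single-problem summit, so `Summit.BirchSwinnertonDyer.BirchSwinnertonDyer.…` repeats a namespace BY DESIGN.
set_option linter.dupNamespace false

noncomputable section

open scoped Classical

open NumberField IsDedekindDomain Field Literature.NumberTheory.EllipticCurves
  Literature.NumberTheory.EllipticCurves.GreenbergSelmer Literature.NumberTheory.EllipticCurves.GreenbergVatsal2000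
  Literature.NumberTheory.GaloisRepresentations

namespace Summit.BirchSwinnertonDyer.BirchSwinnertonDyer.Theorems.ResidualLayer

universe u

variable {K : Type u} [Field K] [NumberField K]
  {M : Type u} [AddCommGroup M] [DistribMulAction (absoluteGaloisGroup K) M] [TopologicalSpace M] [DiscreteTopology M]
  {H H' : Subgroup (absoluteGaloisGroup K)}

/-! ## §1. One place: `unramifiedKer` under `res` -/

/-- Cocycle criterion for `unramifiedKer` (the tree's `CocycleCriteria.resH1Hom_oneCocycleClass_eq_zero_iff` unfolded):
`[z]` is unramified at `v` iff `z` is a coboundary on `H ⊓ I_v`. [cite: GreenbergVatsal2000, §2 p. 17] -/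
theorem oneCocycleClass_mem_unramifiedKer_iff (H : Subgroup (absoluteGaloisGroup K)) (v : HeightOneSpectrum (𝓞 K))
    (z : contOneCocycles (discreteTopRep H M)) :
    oneCocycleClass _ z ∈ unramifiedKer H M v ↔
      ∃ m : M, ∀ x : inertiaIn H v, z.1 (inertiaInToH H v x) = x • m - m := by
  rw [GreenbergVatsal2000.unramifiedKer, AddMonoidHom.mem_ker, CocycleCriteria.resH1Hom_oneCocycleClass_eq_zero_iff]
  rfl

omit [NumberField K] in
/-- `res` on an explicit class is the class of the restricted cocycle. [cite: SerreGaloisCohomology1997, I.§2.4] -/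
theorem resOfLe_oneCocycleClass (h : H' ≤ H) (z : contOneCocycles (discreteTopRep H M)) :
    resOfLe M h (oneCocycleClass _ z) =
      oneCocycleClass _ (contOneCocycles.pullback (subgroupInclusion h)
        (resHomOfEquivariant (subgroupInclusion h) (AddMonoidHom.id M) (fun _ _ ↦ rfl)) z) :=
  map_oneCocycleClass _ _ _ z

/-- **Restriction preserves the unramified condition at `v`**: for `H' ≤ H` and `y ∈ H¹(H, M)` unramified at `v`, `res y ∈ H¹(H', M)`
is unramified at `v` (`H' ⊓ I_v ≤ H ⊓ I_v`; the same coboundary witness). [cite: GreenbergVatsal2000, §2 p. 17]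
[cite: SerreGaloisCohomology1997, I.§2.4] -/
theorem resOfLe_mem_unramifiedKer (h : H' ≤ H) (v : HeightOneSpectrum (𝓞 K)) {y : subgroupH1 H M}
    (hy : y ∈ unramifiedKer H M v) : resOfLe M h y ∈ unramifiedKer H' M v := by
  obtain ⟨z, rfl⟩ := oneCocycleClass_surjective _ y
  rw [oneCocycleClass_mem_unramifiedKer_iff] at hy
  obtain ⟨m, hm⟩ := hy
  rw [resOfLe_oneCocycleClass, oneCocycleClass_mem_unramifiedKer_iff]
  refine ⟨m, fun x ↦ ?_⟩
  have hx : ((x : decomp (K := K) v) : absoluteGaloisGroup K) ∈ H ∧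
      ((x : decomp (K := K) v) : absoluteGaloisGroup K) ∈ inertia v := by
    have := (mem_inertiaIn_iff H' v x).1 x.2
    exact ⟨h this.1, this.2⟩
  have e := hm ⟨(x : decomp (K := K) v), (mem_inertiaIn_iff H v _).2 hx⟩
  rw [contOneCocycles.pullback_apply]
  exact e

/-- **Restriction reflects the unramified condition at `v` when `H ⊓ I_v ≤ H'`**: then `H ⊓ I_v = H' ⊓ I_v`, so `y` is unramified at
`v` as soon as `res y` is. [cite: GreenbergVatsal2000, §2 p. 17] [cite: SerreGaloisCohomology1997, I.§2.4] -/
theorem mem_unramifiedKer_of_resOfLe_mem (h : H' ≤ H) {v : HeightOneSpectrum (𝓞 K)} (hI : H ⊓ inertia v ≤ H')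
    {y : subgroupH1 H M} (hy : resOfLe M h y ∈ unramifiedKer H' M v) : y ∈ unramifiedKer H M v := by
  obtain ⟨z, rfl⟩ := oneCocycleClass_surjective _ y
  rw [resOfLe_oneCocycleClass, oneCocycleClass_mem_unramifiedKer_iff] at hy
  obtain ⟨m, hm⟩ := hy
  rw [oneCocycleClass_mem_unramifiedKer_iff]
  refine ⟨m, fun x ↦ ?_⟩
  have hx := (mem_inertiaIn_iff H v x).1 x.2
  have hx' : ((x : decomp (K := K) v) : absoluteGaloisGroup K) ∈ H' := hI (Subgroup.mem_inf.mpr hx)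
  have e := hm ⟨(x : decomp (K := K) v), (mem_inertiaIn_iff H' v _).2 ⟨hx', hx.2⟩⟩
  rw [contOneCocycles.pullback_apply] at e
  exact e

/-! ## §2. All places outside `S₀ ∪ {p}`, all conjugates: `unramifiedOutside` under `res` -/

variable [H.Normal] [H'.Normal] (p : ℕ) (S₀ : Set (HeightOneSpectrum (𝓞 K)))

/-- **`res` maps `unramifiedOutside H M p S₀` into `unramifiedOutside H' M p S₀`** (`conj_σ ∘ res = res ∘ conj_σ`,
`resOfLe_comp_conjH1`, then `resOfLe_mem_unramifiedKer`). [cite: GreenbergVatsal2000, §2 pp. 16, 23] -/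
theorem resOfLe_mem_unramifiedOutside (h : H' ≤ H) {y : subgroupH1 H M} (hy : y ∈ unramifiedOutside H M p S₀) :
    resOfLe M h y ∈ unramifiedOutside H' M p S₀ := by
  rw [mem_unramifiedOutside_iff] at hy ⊢
  intro v hv hpv σ
  rw [← AddMonoidHom.comp_apply, ← resOfLe_comp_conjH1_holds, AddMonoidHom.comp_apply]
  exact resOfLe_mem_unramifiedKer h v (hy v hv hpv σ)

/-- **`y ∈ unramifiedOutside H M p S₀ ↔ res y ∈ unramifiedOutside H' M p S₀` when `H ⊓ I_v ≤ H'` for every `v ∉ S₀` with `v ∤ p`**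
(e.g. `H' = H ⊓ N` with `N ⊇ I_v` for those `v`: the extension cut out by `N` is unramified outside `S₀ ∪ {p}`).
[cite: GreenbergVatsal2000, §2 pp. 16–17, 23] -/
theorem mem_unramifiedOutside_iff_resOfLe_mem (h : H' ≤ H)
    (hI : ∀ v : HeightOneSpectrum (𝓞 K), v ∉ S₀ → ((p : ℕ) : 𝓞 K) ∉ v.asIdeal → H ⊓ inertia v ≤ H')
    (y : subgroupH1 H M) :
    y ∈ unramifiedOutside H M p S₀ ↔ resOfLe M h y ∈ unramifiedOutside H' M p S₀ := by
  refine ⟨resOfLe_mem_unramifiedOutside p S₀ h, fun hy ↦ ?_⟩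
  rw [mem_unramifiedOutside_iff] at hy ⊢
  intro v hv hpv σ
  refine mem_unramifiedKer_of_resOfLe_mem h (hI v hv hpv) ?_
  rw [← AddMonoidHom.comp_apply, resOfLe_comp_conjH1_holds, AddMonoidHom.comp_apply]
  exact hy v hv hpv σ

/-! ## §3. The instance `H = Γ_{K_∞}`, `H' = Γ_{K_∞} ∩ N` -/

omit [H.Normal] [H'.Normal] in
/-- **Unramified outside `S₀` over `K_∞` versus over `K_∞·F`**: for a `ℤ_p`-extension `κ` (`Γ_{K_∞} = κ.kerSubgroup`) and a normal
subgroup `N ≤ Γ_K` (`F = K̄^N`) containing the inertia group `I_v` of every `v ∉ S₀` with `v ∤ p`, a class of `H¹(Γ_{K_∞}, M)` is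
unramified outside `S₀ ∪ {p}` iff its restriction to `Γ_{K_∞} ∩ N` is. With `K = ℚ`, `p = 2`, `N = Γ_{ℚ(√Δ_W)}` on the habitat
(`S₀ ⊇ bad(W)`, `Δ_min ≡ 5 (8)`) this is the unramified clause of `R⁺_{S₀}(W[2]/ℚ_∞)` read over `ℚ(√Δ_W)·ℚ_∞`.
[cite: GreenbergVatsal2000, §2 pp. 16–17, 23] -/
theorem mem_unramifiedOutside_kerSubgroup_iff_resOfLe_inf_mem [Fact p.Prime] (κ : ZpExtension K p)
    (N : Subgroup (absoluteGaloisGroup K)) [N.Normal]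
    (hN : ∀ v : HeightOneSpectrum (𝓞 K), v ∉ S₀ → ((p : ℕ) : 𝓞 K) ∉ v.asIdeal → inertia v ≤ N)
    (y : subgroupH1 κ.kerSubgroup M) :
    y ∈ unramifiedOutside κ.kerSubgroup M p S₀ ↔
      resOfLe M (inf_le_left : κ.kerSubgroup ⊓ N ≤ κ.kerSubgroup) y ∈ unramifiedOutside (κ.kerSubgroup ⊓ N) M p S₀ :=
  mem_unramifiedOutside_iff_resOfLe_mem p S₀ inf_le_left
    (fun v hv hpv ↦ le_inf inf_le_left ((inf_le_right.trans (hN v hv hpv)))) y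

end Summit.BirchSwinnertonDyer.BirchSwinnertonDyer.Theorems.ResidualLayer

end
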